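import Summits.Ventures.PercRepro.C026ClusterFlip
import Summits.Ventures.PercRepro.C026TwoCluster
import Summits.Ventures.PercRepro.C026PFunE00Count

/-!
# The Good-degree bridge: C-041 `(G⅔)` implies THEOREM L2 on every skeleton (p6, gen 20)

Setting of `C026PFunE00Count`: a skeleton `(G; a, b, c)` with probe `c` and two live vertices `a, b`;
a configuration `S : Config E` is the RED edge set, `Sᶜ` the BLUE one; `(D,A)` = the configurations in
which `c, a, b` are pairwise red-joined and pairwise blue-separated.  For `S ∈ (D,A)` and a live
vertex `t`, `S` is **`Good_t`** when the other live vertex is red-reachable from `c` by a walk avoiding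
the blue cluster of `t` (mine-3's §37 (b), `WalkAvoiding` of `C026TwoCluster`); `g(S) := [Good_a] +
[Good_b]` is the Good-degree.  The cell's ROW C-041 (mine-3, CONJECTURES.md v347) is

  `(G⅔)`:  `2·n(D,A) ≤ 3·(#Good_a + #Good_b)` — the average Good-degree of a `(D,A)` source is `≥ 2/3`.

This file proves, kernel-checked, mine-3's STAGE 2 and the bridge from `(G⅔)` to THEOREM L2:

* `walkAvoiding_kSwapInv` — a red walk avoiding the blue cluster of `a` survives the closed-cluster
  flip `Φ_a = kSwapInv a` (p5's Lemma Φ, `C026ClusterFlip`): the flip only touches edges at that cluster;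
* `kSwapInv_conn_of_good` — for a `(D,A)` source in `Good_a`, `Φ_a(S)` has red type `B₂`
  (`c ~ b`, `c ≁ a`: the red cluster of `a` in `Φ_a(S)` is the blue cluster of `a` in `S`, which does
  not contain `c`);
* `card_goodA_le`, `card_goodB_le` — `#Good_a ≤ #B₂` and `#Good_b ≤ #B₁` (`Φ_a`, `Φ_b` are injective);
* `card_good_add_good_le` — `#Good_a + #Good_b ≤ |B|` (STAGE 2: `Good_a ∪ Good_b` injects into `B`);
* `card_DA_le_of_goodDegree` — `(G⅔)` ⟹ `2·n(D,A) ≤ 3·|B|`, hence `n(D,A) ≤ 2·|B|`;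
* `pFun_liveCells_nonneg_of_goodDegree` — `(G⅔)` ⟹ `(E00)` (via `pFun_liveCells_nonneg_of_two_mul`);
* `pFun_twoCells_nonneg_of_goodDegree`, `pFun_threeCells_nonneg_of_goodDegree` — `(G⅔)` ⟹
  THEOREM L2 (bare probe / live probe): `(P) ≥ 0` at every band state of the probe and the two live
  vertices.

So CONJECTURE (P) with at most two live vertices is a corollary of ROW C-041 on the skeleton; the
`(D,A)` sources, `Good_t` and `B_t` are the literal filters of `C026PFunE00Count`.  No distinctness of
`a, b, c` is assumed anywhere.
-/

namespace PercRepro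

namespace MultiGraph

open Finset

variable {V E : Type*} {G : MultiGraph V E}

/-- An avoiding walk only uses edges with both endpoints outside the avoided set; it survives any
change of the configuration on the edges at that set. -/
theorem reflTransGen_avoiding_of_agree {ω ω' : Config E} {W : Set V} {u v : V}
    (hag : ∀ e, G.fst e ∉ W → G.snd e ∉ W → ω e = ω' e) (hu : u ∉ W)
    (h : Relation.ReflTransGen (fun x y => G.OpenAdj ω x y ∧ y ∉ W) u v) :
    Relation.ReflTransGen (fun x y => G.OpenAdj ω' x y ∧ y ∉ W) u v := by
  induction h using Relation.ReflTransGen.head_induction_on with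
  | refl => exact Relation.ReflTransGen.refl
  | @head x y hxy _ ih =>
    refine Relation.ReflTransGen.head ⟨?_, hxy.2⟩ (ih hxy.2)
    obtain ⟨e, he, hend⟩ := hxy.1
    refine ⟨e, ?_, hend⟩
    rcases hend with ⟨hx, hy⟩ | ⟨hx, hy⟩
    · rw [← hag e (by rw [hx]; exact hu) (by rw [hy]; exact hxy.2)]
      exact he
    · rw [← hag e (by rw [hx]; exact hxy.2) (by rw [hy]; exact hu)]
      exact he

/-- **The flip keeps the avoiding walks**: a red walk from `c` to `b` avoiding the blue cluster of `a`
is still open after the closed-cluster flip `Φ_a = kSwapInv a` (which flips only the edges at that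
cluster). -/
theorem walkAvoiding_kSwapInv {S : Config E} {a b c : V}
    (h : G.WalkAvoiding S (G.cluster Sᶜ a) c b) :
    G.WalkAvoiding (G.kSwapInv a S) (G.cluster Sᶜ a) c b := by
  refine ⟨h.1, reflTransGen_avoiding_of_agree ?_ h.1 h.2⟩
  intro e h1 h2
  refine (G.kSwapInv_apply_of_notMem ?_).symm
  rw [mem_edgesAt]
  exact not_or.2 ⟨h1, h2⟩

/-- **STAGE 2, the image type** (mine-3 §37 (b)): for a configuration with `c ≁_blue a` in which some
red walk from `c` to `b` avoids the blue cluster of `a`, the flip `Φ_a(S)` has red type `B₂`: `c ~ b`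
and `c ≁ a`. -/
theorem kSwapInv_conn_of_good {S : Config E} {a b c : V} (hca : ¬ G.Conn Sᶜ c a)
    (h : G.WalkAvoiding S (G.cluster Sᶜ a) c b) :
    G.Conn (G.kSwapInv a S) c b ∧ ¬ G.Conn (G.kSwapInv a S) c a := by
  refine ⟨(walkAvoiding_kSwapInv h).conn, fun hc => hca ?_⟩
  exact ((conn_kSwapInv_iff a c S).1 hc.symm).symm

section Count

variable [Fintype V] [DecidableEq V] [Fintype E] [DecidableEq E]

omit [Fintype V] [DecidableEq V] in
open Classical in
/-- **`#Good_a ≤ #B₂`**: the closed-cluster flip `Φ_a` injects the `(D,A)` sources in `Good_a` (some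
red `c`–`b` walk avoids the blue cluster of `a`) into the configurations of red type `B₂`. -/
theorem card_goodA_le (a b c : V) :
    (univ.filter fun S : Config E => ((G.Conn S c a ∧ G.Conn S c b) ∧
        (¬ G.Conn Sᶜ c a ∧ ¬ G.Conn Sᶜ c b ∧ ¬ G.Conn Sᶜ a b)) ∧
        G.WalkAvoiding S (G.cluster Sᶜ a) c b).card ≤
      (univ.filter fun T : Config E => G.Conn T c b ∧ ¬ G.Conn T c a).card := by
  refine Finset.card_le_card_of_injOn (G.kSwapInv a) ?_ ?_
  · intro S hS
    simp only [coe_filter, mem_univ, true_and, Set.mem_setOf_eq] at hS ⊢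
    exact kSwapInv_conn_of_good hS.1.2.1 hS.2
  · intro S _ S' _ h
    exact kSwapInv_injective a h

omit [Fintype V] [DecidableEq V] in
open Classical in
/-- **`#Good_b ≤ #B₁`**: the closed-cluster flip `Φ_b` injects the `(D,A)` sources in `Good_b` (some
red `c`–`a` walk avoids the blue cluster of `b`) into the configurations of red type `B₁`. -/
theorem card_goodB_le (a b c : V) :
    (univ.filter fun S : Config E => ((G.Conn S c a ∧ G.Conn S c b) ∧
        (¬ G.Conn Sᶜ c a ∧ ¬ G.Conn Sᶜ c b ∧ ¬ G.Conn Sᶜ a b)) ∧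
        G.WalkAvoiding S (G.cluster Sᶜ b) c a).card ≤
      (univ.filter fun T : Config E => G.Conn T c a ∧ ¬ G.Conn T c b).card := by
  refine Finset.card_le_card_of_injOn (G.kSwapInv b) ?_ ?_
  · intro S hS
    simp only [coe_filter, mem_univ, true_and, Set.mem_setOf_eq] at hS ⊢
    exact kSwapInv_conn_of_good hS.1.2.2.1 hS.2
  · intro S _ S' _ h
    exact kSwapInv_injective b h

omit [Fintype V] [DecidableEq V] in
open Classical in
/-- `|B| = #B₁ + #B₂`: the red type `B` splits into the two disjoint one-sided types. -/
theorem card_B_eq_add (a b c : V) :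
    (univ.filter fun T : Config E =>
        (G.Conn T c a ∧ ¬ G.Conn T c b) ∨ (G.Conn T c b ∧ ¬ G.Conn T c a)).card =
      (univ.filter fun T : Config E => G.Conn T c a ∧ ¬ G.Conn T c b).card +
        (univ.filter fun T : Config E => G.Conn T c b ∧ ¬ G.Conn T c a).card := by
  rw [Finset.filter_or, Finset.card_union_of_disjoint]
  rw [Finset.disjoint_filter]
  intro T _ h1 h2
  exact h1.2 h2.1

omit [Fintype V] [DecidableEq V] in
open Classical in
/-- **STAGE 2** (mine-3 §37 (b), kernel form): `#Good_a + #Good_b ≤ |B|`. -/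
theorem card_good_add_good_le (a b c : V) :
    (univ.filter fun S : Config E => ((G.Conn S c a ∧ G.Conn S c b) ∧
        (¬ G.Conn Sᶜ c a ∧ ¬ G.Conn Sᶜ c b ∧ ¬ G.Conn Sᶜ a b)) ∧
        G.WalkAvoiding S (G.cluster Sᶜ a) c b).card +
      (univ.filter fun S : Config E => ((G.Conn S c a ∧ G.Conn S c b) ∧
        (¬ G.Conn Sᶜ c a ∧ ¬ G.Conn Sᶜ c b ∧ ¬ G.Conn Sᶜ a b)) ∧
        G.WalkAvoiding S (G.cluster Sᶜ b) c a).card ≤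
      (univ.filter fun T : Config E =>
        (G.Conn T c a ∧ ¬ G.Conn T c b) ∨ (G.Conn T c b ∧ ¬ G.Conn T c a)).card := by
  rw [card_B_eq_add]
  have h1 := card_goodA_le (G := G) a b c
  have h2 := card_goodB_le (G := G) a b c
  omega

omit [Fintype V] [DecidableEq V] in
open Classical in
/-- **The Good-degree count pays the sources**: ROW C-041 `(G⅔)` — `2·n(D,A) ≤ 3·(#Good_a + #Good_b)`
— gives `2·n(D,A) ≤ 3·|B|`, in particular the lossy form `n(D,A) ≤ 2·|B|`. -/
theorem card_DA_le_of_goodDegree (a b c : V)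
    (hG : 2 * (univ.filter fun S : Config E => (G.Conn S c a ∧ G.Conn S c b) ∧
          (¬ G.Conn Sᶜ c a ∧ ¬ G.Conn Sᶜ c b ∧ ¬ G.Conn Sᶜ a b)).card ≤
        3 * ((univ.filter fun S : Config E => ((G.Conn S c a ∧ G.Conn S c b) ∧
            (¬ G.Conn Sᶜ c a ∧ ¬ G.Conn Sᶜ c b ∧ ¬ G.Conn Sᶜ a b)) ∧
            G.WalkAvoiding S (G.cluster Sᶜ a) c b).card +
          (univ.filter fun S : Config E => ((G.Conn S c a ∧ G.Conn S c b) ∧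
            (¬ G.Conn Sᶜ c a ∧ ¬ G.Conn Sᶜ c b ∧ ¬ G.Conn Sᶜ a b)) ∧
            G.WalkAvoiding S (G.cluster Sᶜ b) c a).card)) :
    2 * (univ.filter fun S : Config E => (G.Conn S c a ∧ G.Conn S c b) ∧
          (¬ G.Conn Sᶜ c a ∧ ¬ G.Conn Sᶜ c b ∧ ¬ G.Conn Sᶜ a b)).card ≤
      3 * (univ.filter fun T : Config E =>
          (G.Conn T c a ∧ ¬ G.Conn T c b) ∨ (G.Conn T c b ∧ ¬ G.Conn T c a)).card := by
  have h := card_good_add_good_le (G := G) a b c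
  omega

open Classical in
/-- **`(G⅔)` ⟹ `(E00)`**: under ROW C-041 the `k = 2` all-corner value of `(P)` is nonnegative. -/
theorem pFun_liveCells_nonneg_of_goodDegree (a b c : V)
    (hG : 2 * (univ.filter fun S : Config E => (G.Conn S c a ∧ G.Conn S c b) ∧
          (¬ G.Conn Sᶜ c a ∧ ¬ G.Conn Sᶜ c b ∧ ¬ G.Conn Sᶜ a b)).card ≤
        3 * ((univ.filter fun S : Config E => ((G.Conn S c a ∧ G.Conn S c b) ∧
            (¬ G.Conn Sᶜ c a ∧ ¬ G.Conn Sᶜ c b ∧ ¬ G.Conn Sᶜ a b)) ∧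
            G.WalkAvoiding S (G.cluster Sᶜ a) c b).card +
          (univ.filter fun S : Config E => ((G.Conn S c a ∧ G.Conn S c b) ∧
            (¬ G.Conn Sᶜ c a ∧ ¬ G.Conn Sᶜ c b ∧ ¬ G.Conn Sᶜ a b)) ∧
            G.WalkAvoiding S (G.cluster Sᶜ b) c a).card)) :
    0 ≤ G.pFun c (liveCells a b) (liveCells a b) univ := by
  apply pFun_liveCells_nonneg_of_two_mul
  have h := card_DA_le_of_goodDegree (G := G) a b c hG
  omega

open Classical in
/-- **`(G⅔)` ⟹ THEOREM L2 (bare probe)**: under ROW C-041 on the skeleton, `(P) ≥ 0` at every band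
state of the two live vertices. -/
theorem pFun_twoCells_nonneg_of_goodDegree (a b c : V)
    (hG : 2 * (univ.filter fun S : Config E => (G.Conn S c a ∧ G.Conn S c b) ∧
          (¬ G.Conn Sᶜ c a ∧ ¬ G.Conn Sᶜ c b ∧ ¬ G.Conn Sᶜ a b)).card ≤
        3 * ((univ.filter fun S : Config E => ((G.Conn S c a ∧ G.Conn S c b) ∧
            (¬ G.Conn Sᶜ c a ∧ ¬ G.Conn Sᶜ c b ∧ ¬ G.Conn Sᶜ a b)) ∧
            G.WalkAvoiding S (G.cluster Sᶜ a) c b).card +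
          (univ.filter fun S : Config E => ((G.Conn S c a ∧ G.Conn S c b) ∧
            (¬ G.Conn Sᶜ c a ∧ ¬ G.Conn Sᶜ c b ∧ ¬ G.Conn Sᶜ a b)) ∧
            G.WalkAvoiding S (G.cluster Sᶜ b) c a).card))
    {x₁ K₁ x₂ K₂ : ℝ}
    (hx₁ : 0 ≤ x₁ ∧ x₁ ≤ 1) (hx₂ : 0 ≤ x₂ ∧ x₂ ≤ 1) (hK₁ : kMin x₁ ≤ K₁) (hK₂ : kMin x₂ ≤ K₂) :
    0 ≤ G.pFun c (twoCells a b x₁ x₂) (twoCells a b K₁ K₂) univ :=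
  pFun_twoCells_nonneg_of_corner a b c hx₁ hx₂ hK₁ hK₂
    (pFun_liveCells_nonneg_of_goodDegree a b c hG)

open Classical in
/-- **`(G⅔)` ⟹ THEOREM L2 (live probe)**: under ROW C-041 on the skeleton, `(P) ≥ 0` at every band
state of the probe and of the two live vertices. -/
theorem pFun_threeCells_nonneg_of_goodDegree (a b c : V)
    (hG : 2 * (univ.filter fun S : Config E => (G.Conn S c a ∧ G.Conn S c b) ∧
          (¬ G.Conn Sᶜ c a ∧ ¬ G.Conn Sᶜ c b ∧ ¬ G.Conn Sᶜ a b)).card ≤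
        3 * ((univ.filter fun S : Config E => ((G.Conn S c a ∧ G.Conn S c b) ∧
            (¬ G.Conn Sᶜ c a ∧ ¬ G.Conn Sᶜ c b ∧ ¬ G.Conn Sᶜ a b)) ∧
            G.WalkAvoiding S (G.cluster Sᶜ a) c b).card +
          (univ.filter fun S : Config E => ((G.Conn S c a ∧ G.Conn S c b) ∧
            (¬ G.Conn Sᶜ c a ∧ ¬ G.Conn Sᶜ c b ∧ ¬ G.Conn Sᶜ a b)) ∧
            G.WalkAvoiding S (G.cluster Sᶜ b) c a).card))
    {z κ x₁ K₁ x₂ K₂ : ℝ}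
    (hz : 0 ≤ z ∧ z ≤ 1) (hκ : kMin z ≤ κ) (hx₁ : 0 ≤ x₁ ∧ x₁ ≤ 1) (hx₂ : 0 ≤ x₂ ∧ x₂ ≤ 1)
    (hK₁ : kMin x₁ ≤ K₁) (hK₂ : kMin x₂ ≤ K₂) :
    0 ≤ G.pFun c (threeCells c a b z x₁ x₂) (threeCells c a b κ K₁ K₂) univ :=
  pFun_threeCells_nonneg_of_E00 c a b hz hκ hx₁ hx₂ hK₁ hK₂
    (pFun_liveCells_nonneg_of_goodDegree a b c hG)

end Count

end MultiGraph

end PercRepro
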